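import Summits.RiemannHypothesis.RiemannHypothesis.Theorems.ScrewManifestCertDefs

/-!
# ScrewManifestCertDual — part of the integer-screw manifest-certificate development

Batches 2 and 3: nestedness of manifest certificates, the unstructured direction, dual certificates
(soundness proved) and signed Laplacian ("top-block") duals with their pairing identity.
(Split of `ScrewManifestCert.lean` v1.5 for the Theorems line cap; overview and file layout in
`Summits.RiemannHypothesis.RiemannHypothesis.Theorems.ScrewManifestCertDefs`.
Nothing in this file bears on the truth of RH.)
-/

set_option linter.dupNamespace false
set_option autoImplicit false

namespace Summit.RiemannHypothesis.RiemannHypothesis.Theorems.IntegerScrew.Manifest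

open Literature.NumberTheory.LFunctions Matrix

/-! ## Second batch (gen15, same session): nestedness, the unstructured direction, and the
screw-function form of the wave part -/

section Batch2

open Finset

/-- Strict diagonal dominance passes to principal submatrices along an injective node map. -/
theorem isStrictDiagDominant_submatrix {n n' : ℕ} {R : Matrix (Fin n) (Fin n) ℝ}
    (hR : IsStrictDiagDominant R) (e : Fin n' → Fin n) (he : Function.Injective e) :
    IsStrictDiagDominant (R.submatrix e e) := by
  intro i
  simp only [Matrix.submatrix_apply]
  calc ∑ j ∈ univ.erase i, |R (e i) (e j)|
      = ∑ j ∈ (univ.erase i).image e, |R (e i) j| := by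
        rw [Finset.sum_image fun a _ b _ h => he h]
    _ ≤ ∑ j ∈ univ.erase (e i), |R (e i) j| := by
        apply Finset.sum_le_sum_of_subset_of_nonneg
        · intro j hj
          rw [Finset.mem_image] at hj
          obtain ⟨a, ha, rfl⟩ := hj
          rw [Finset.mem_erase] at ha ⊢
          exact ⟨fun h => ha.1 (he h), Finset.mem_univ _⟩
        · intro j _ _
          exact abs_nonneg _
    _ < R (e i) (e i) := hR (e i)

/-- The remainder of the SAME atoms at a lower level is the principal submatrix. -/
theorem remainder_castLE {n n' : ℕ} (h : n' ≤ n) (K : ℕ) (t w : Fin K → ℝ) (wJ : ℝ) :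
    remainder n' K t w wJ = (remainder n K t w wJ).submatrix (Fin.castLE h) (Fin.castLE h) := by
  ext i j
  simp [remainder, screwMatrix, waveAtom, onesMat, node, Matrix.sum_apply]

/-- RH-FREE, PROVED: NESTEDNESS of the format. -/
theorem manifestCertNested_proof : ManifestCertNested := by
  intro n n' tmin T h hc
  obtain ⟨K, t, w, wJ, hk, hwJ, hR⟩ := hc
  refine ⟨K, t, w, wJ, hk, hwJ, ?_⟩
  rw [remainder_castLE h]
  exact isStrictDiagDominant_submatrix hR _ (Fin.castLE_injective h)

/-- RH-FREE: the UNSTRUCTURED format (any real Gram part `GᵀG`, no band limit) is sound … -/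
def UnstructuredCertSound : Prop :=
  ∀ (n K : ℕ) (G : Matrix (Fin K) (Fin n) ℝ),
    IsStrictDiagDominant (screwMatrix n - G.transpose * G) → (screwMatrix n).PosDef

/-- … PROVED (this is the `→` half of `UnstructuredCertIffPosDef`; the `←` half is Cholesky of
`S − εI` with remainder `εI`). -/
theorem unstructuredCertSound_proof : UnstructuredCertSound := by
  intro n K G hdd
  have hP : (G.transpose * G).PosSemidef := by
    have h0 := posSemidef_conjTranspose_mul_self G
    rwa [Matrix.conjTranspose_eq_transpose_of_trivial] at h0
  have hH : (screwMatrix n - G.transpose * G).IsHermitian :=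
    (screwMatrix_isHermitian n).sub hP.isHermitian
  have h1 := (strictDDPosDef_proof n _ hH hdd).add_posSemidef hP
  rwa [sub_add_cancel] at h1

/-- The BAND-LIMITED SCREW-TYPE FUNCTION of an atom list: `φ(u) = Σ_k w_k (1 − cos(t_k u))/t_k²`
(a nonnegative cosine combination with frequencies `t_k`; under RH, `Ψ` itself is the `T = ∞`
member with atoms `(γ, 2)`). -/
noncomputable def atomScrew (K : ℕ) (t w : Fin K → ℝ) (u : ℝ) : ℝ :=
  ∑ k, w k * (1 - Real.cos (t k * u)) / t k ^ 2

/-- RH-FREE, PROVED: the wave part IS the Kreĭn kernel of `φ` on the nodes,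
`(Σ_k w_k A_{t_k})(i,j) = φ(x_i) + φ(x_j) − φ(x_i − x_j)` — so a manifest certificate says exactly:
the Kreĭn kernel of `Ψ − φ` on `log 2, …, log M`, minus the constant `wJ`, is strictly diagonally
dominant for some band-limited `φ` of this form (the typed `P_M` read as a statement about ONE real
function `Ψ − φ`). -/
theorem wavePart_apply (n K : ℕ) (t w : Fin K → ℝ) (i j : Fin n) :
    (∑ k, w k • waveAtom n (t k)) i j
      = atomScrew K t w (node n i) + atomScrew K t w (node n j)
        - atomScrew K t w (node n i - node n j) := by
  simp only [Matrix.sum_apply, Matrix.smul_apply, waveAtom, Matrix.of_apply, smul_eq_mul, atomScrew,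
    ← Finset.sum_add_distrib, ← Finset.sum_sub_distrib]
  refine Finset.sum_congr rfl fun k _ => ?_
  ring

/-- The remainder in screw-function form: `R(i,j) = G_{Ψ−φ}(x_i, x_j) − wJ` with
`G_η(x,y) = η(x) + η(y) − η(x − y)`. -/
theorem remainder_apply (n K : ℕ) (t w : Fin K → ℝ) (wJ : ℝ) (i j : Fin n) :
    remainder n K t w wJ i j
      = (zetaScrew (node n i) - atomScrew K t w (node n i))
        + (zetaScrew (node n j) - atomScrew K t w (node n j))
        - (zetaScrew (node n i - node n j) - atomScrew K t w (node n i - node n j)) - wJ := by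
  simp only [remainder, Matrix.sub_apply, Matrix.smul_apply, wavePart_apply, screwMatrix, onesMat,
    Matrix.of_apply, node, zetaScrewKernel_def, smul_eq_mul, mul_one]
  ring

end Batch2


/-! ## Third batch (gen16): the DUAL side — dual certificates (sos-dualcert/v1 typed, SOUNDNESS PROVED),
Laplacian ("top-block") duals and their pairing identity (PROVED), and the typed FIRST LEMMA of the
`NyquistFloor` line: a fixed finite signed Laplacian on the top `L` nodes is a dual certificate of
`¬ P_M(t_min, T)` for every `T ≤ θ·(M − s)` and EVERY `t_min > 0`, for all `M ≥ M₀` — it pairs `S_M`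
only through `Ψ` on `(0, log 2)` (the prime-free closed form `zetaScrew_eq_of_abs_lt_log_two`):
a LINEAR Nyquist floor that goes neither through zeros nor through primes. -/

section Batch3

open Finset

/-- Frobenius pairing `⟨A, Y⟩ = Σ_{i,j} A_{ij} Y_{ij}`. -/
def frob {n : ℕ} (A Y : Matrix (Fin n) (Fin n) ℝ) : ℝ := ∑ i, ∑ j, A i j * Y i j

/-- The Frobenius pairing `frob` is additive in its left argument. -/
theorem frob_add_left {n : ℕ} (A B Y : Matrix (Fin n) (Fin n) ℝ) :
    frob (A + B) Y = frob A Y + frob B Y := by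
  simp only [frob, Matrix.add_apply, add_mul, Finset.sum_add_distrib]

/-- The Frobenius pairing `frob` respects subtraction in its left argument. -/
theorem frob_sub_left {n : ℕ} (A B Y : Matrix (Fin n) (Fin n) ℝ) :
    frob (A - B) Y = frob A Y - frob B Y := by
  simp only [frob, Matrix.sub_apply, sub_mul, Finset.sum_sub_distrib]

/-- The Frobenius pairing `frob` is homogeneous in its left argument. -/
theorem frob_smul_left {n : ℕ} (r : ℝ) (A Y : Matrix (Fin n) (Fin n) ℝ) :
    frob (r • A) Y = r * frob A Y := by
  simp only [frob, Matrix.smul_apply, smul_eq_mul, Finset.mul_sum, mul_assoc]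

/-- The Frobenius pairing `frob` commutes with finite sums in its left argument. -/
theorem frob_sum_left {n K : ℕ} (A : Fin K → Matrix (Fin n) (Fin n) ℝ) (Y : Matrix (Fin n) (Fin n) ℝ) :
    frob (∑ k, A k) Y = ∑ k, frob (A k) Y := by
  simp only [frob, Matrix.sum_apply, Finset.sum_mul]
  calc ∑ i, ∑ j, ∑ k, A k i j * Y i j = ∑ i, ∑ k, ∑ j, A k i j * Y i j :=
        Finset.sum_congr rfl fun i _ => Finset.sum_comm
    _ = ∑ k, ∑ i, ∑ j, A k i j * Y i j := Finset.sum_comm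

/-- The Frobenius pairing `frob` is homogeneous in its right argument. -/
theorem frob_smul_right {n : ℕ} (r : ℝ) (A Y : Matrix (Fin n) (Fin n) ℝ) :
    frob A (r • Y) = r * frob A Y := by
  simp only [frob, Matrix.smul_apply, smul_eq_mul, Finset.mul_sum]
  exact Finset.sum_congr rfl fun i _ => Finset.sum_congr rfl fun j _ => by ring

/-- The Frobenius pairing `frob` commutes with finite sums in its right argument. -/
theorem frob_sum_right {n E : ℕ} (A : Matrix (Fin n) (Fin n) ℝ) (Y : Fin E → Matrix (Fin n) (Fin n) ℝ) :
    frob A (∑ e, Y e) = ∑ e, frob A (Y e) := by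
  simp only [frob, Matrix.sum_apply, Finset.mul_sum]
  calc ∑ i, ∑ j, ∑ e, A i j * Y e i j = ∑ i, ∑ e, ∑ j, A i j * Y e i j :=
        Finset.sum_congr rfl fun i _ => Finset.sum_comm
    _ = ∑ e, ∑ i, ∑ j, A i j * Y e i j := Finset.sum_comm

/-- `Y` lies in the DUAL CONE `DD*` of the (symmetric) diagonally dominant matrices:
`Y_ii ≥ 0` and `2|Y_ij| ≤ Y_ii + Y_jj` (pair `Y` with the extreme rays `E_ii`, `(e_i ± e_j)(e_i ± e_j)ᵀ`). -/
def InDDDual {n : ℕ} (Y : Matrix (Fin n) (Fin n) ℝ) : Prop :=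
  (∀ i, 0 ≤ Y i i) ∧ ∀ i j, i ≠ j → 2 * |Y i j| ≤ Y i i + Y j j

/-- RH-FREE (format sos-dualcert/v1, typed; extended to ALL of `[t_min, T]`): a DUAL CERTIFICATE
against manifest certificates of `S_{n+1}` with frequencies in `[t_min, T]`:
`Y ∈ DD*`, `⟨A_t, Y⟩ ≥ 0` for `t ∈ [t_min, T]`, `⟨J, Y⟩ ≥ 0`, `⟨S_{n+1}, Y⟩ < 0`. -/
def DualCert (n : ℕ) (tmin T : ℝ) (Y : Matrix (Fin n) (Fin n) ℝ) : Prop :=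
  InDDDual Y ∧ (∀ t, tmin ≤ t → t ≤ T → 0 ≤ frob (waveAtom n t) Y) ∧
    0 ≤ frob (onesMat n) Y ∧ frob (screwMatrix n) Y < 0

/-- A symmetric strictly diagonally dominant matrix pairs nonnegatively with `DD*`:
`⟨R, Y⟩ ≥ Σ_i Y_ii (R_ii − Σ_{j≠i} |R_ij|) ≥ 0`. -/
theorem frob_nonneg_of_dd {n : ℕ} (R Y : Matrix (Fin n) (Fin n) ℝ) (hH : R.IsHermitian)
    (hR : IsStrictDiagDominant R) (hY : InDDDual Y) : 0 ≤ frob R Y := by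
  have hsym : ∀ i j, R j i = R i j := fun i j => by simpa using hH.apply i j
  -- diagonal / off-diagonal split
  have hsplit : frob R Y = ∑ i, R i i * Y i i + ∑ i, ∑ j ∈ univ.erase i, R i j * Y i j := by
    rw [← Finset.sum_add_distrib]
    unfold frob
    refine Finset.sum_congr rfl fun i _ => ?_
    rw [← Finset.add_sum_erase _ _ (mem_univ i)]
  -- termwise lower bound of the off-diagonal part
  have hterm : ∀ i ∈ (univ : Finset (Fin n)), ∀ j ∈ univ.erase i,
      -((|R i j| * Y i i + |R i j| * Y j j) / 2) ≤ R i j * Y i j := by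
    intro i _ j hj
    have hne : i ≠ j := fun h => (Finset.mem_erase.mp hj).1 h.symm
    have h2 := hY.2 i j hne
    have h3 : -(|R i j| * |Y i j|) ≤ R i j * Y i j := by
      rw [← abs_mul]
      exact neg_abs_le _
    nlinarith [abs_nonneg (R i j), abs_nonneg (Y i j)]
  have hoff := Finset.sum_le_sum fun i hi => Finset.sum_le_sum (hterm i hi)
  -- the two halves of the bound
  have hneg : ∑ i, ∑ j ∈ univ.erase i, -((|R i j| * Y i i + |R i j| * Y j j) / 2)
      = -((∑ i, ∑ j ∈ univ.erase i, |R i j| * Y i i) / 2)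
        - (∑ i, ∑ j ∈ univ.erase i, |R i j| * Y j j) / 2 := by
    simp only [Finset.sum_neg_distrib, Finset.sum_add_distrib, Finset.sum_div, add_div]
    ring
  have hswap : ∑ i, ∑ j ∈ univ.erase i, |R i j| * Y j j
      = ∑ i, ∑ j ∈ univ.erase i, |R i j| * Y i i := by
    rw [offdiag_swap (fun i j => |R i j| * Y j j)]
    refine Finset.sum_congr rfl fun i _ => Finset.sum_congr rfl fun j _ => ?_
    rw [hsym i j]
  have hdiag : ∑ i, R i i * Y i i - ∑ i, ∑ j ∈ univ.erase i, |R i j| * Y i i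
      = ∑ i, Y i i * (R i i - ∑ j ∈ univ.erase i, |R i j|) := by
    rw [← Finset.sum_sub_distrib]
    refine Finset.sum_congr rfl fun i _ => ?_
    rw [mul_sub, Finset.mul_sum]
    congr 1
    · ring
    · exact Finset.sum_congr rfl fun j _ => by ring
  have hpos : 0 ≤ ∑ i, Y i i * (R i i - ∑ j ∈ univ.erase i, |R i j|) :=
    Finset.sum_nonneg fun i _ => mul_nonneg (hY.1 i) (sub_nonneg.mpr (le_of_lt (hR i)))
  rw [hneg, hswap] at hoff
  rw [hsplit]
  linarith [hoff, hpos, hdiag]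

/-- RH-FREE, PROVED: SOUNDNESS OF DUAL CERTIFICATES — a dual certificate against height `T`
excludes every manifest certificate with frequencies in `[t_min, T]`
(`⟨S, Y⟩ = ⟨R, Y⟩ + Σ_k w_k ⟨A_{t_k}, Y⟩ + wJ ⟨J, Y⟩ ≥ 0`). -/
theorem dualCert_sound {n : ℕ} {tmin T : ℝ} {Y : Matrix (Fin n) (Fin n) ℝ}
    (hY : DualCert n tmin T Y) : ¬ ManifestCert n tmin T := by
  rintro ⟨K, t, w, wJ, hk, hwJ, hR⟩
  obtain ⟨hdd, hwave, hJ, hS⟩ := hY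
  have hP := wavePart_posSemidef n K t w wJ (fun k => (hk k).2.2.2) hwJ
  have hRH : (remainder n K t w wJ).IsHermitian := by
    have h1 : remainder n K t w wJ
        = screwMatrix n - ((∑ k, w k • waveAtom n (t k)) + wJ • onesMat n) := by
      simp only [remainder]
      abel
    rw [h1]
    exact (screwMatrix_isHermitian n).sub hP.isHermitian
  have h0 : 0 ≤ frob (remainder n K t w wJ) Y := frob_nonneg_of_dd _ _ hRH hR hdd
  have hdecomp : screwMatrix n
      = remainder n K t w wJ + (∑ k, w k • waveAtom n (t k)) + wJ • onesMat n := by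
    simp only [remainder]
    abel
  have hlin : frob (screwMatrix n) Y = frob (remainder n K t w wJ) Y
      + ∑ k, w k * frob (waveAtom n (t k)) Y + wJ * frob (onesMat n) Y := by
    rw [hdecomp, frob_add_left, frob_add_left, frob_sum_left, frob_smul_left]
    simp only [frob_smul_left]
  have hw : 0 ≤ ∑ k, w k * frob (waveAtom n (t k)) Y :=
    Finset.sum_nonneg fun k _ =>
      mul_nonneg (hk k).2.2.2 (hwave (t k) (hk k).1 (hk k).2.1)
  have hJ' : 0 ≤ wJ * frob (onesMat n) Y := mul_nonneg hwJ hJ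
  linarith

/-! ### Laplacian duals: `Y = Σ_e c_e (δ_{p_e} − δ_{q_e})(δ_{p_e} − δ_{q_e})ᵀ` (signed edge weights) -/

/-- The edge vector `δ_p − δ_q`. -/
def edgeVec (n : ℕ) (p q : Fin n) : Fin n → ℝ := Pi.single p 1 - Pi.single q 1

/-- The signed LAPLACIAN of an edge list with real weights (zero row sums; `⟨J, Y⟩ = 0`). -/
def lapY (n E : ℕ) (p q : Fin E → Fin n) (c : Fin E → ℝ) : Matrix (Fin n) (Fin n) ℝ :=
  ∑ e, c e • Matrix.vecMulVec (edgeVec n (p e) (q e)) (edgeVec n (p e) (q e))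

/-- Pairing of a matrix with one rank-one edge term: `⟨K, (δ_p−δ_q)(δ_p−δ_q)ᵀ⟩ = K_pp − K_pq − K_qp + K_qq`. -/
theorem frob_vecMulVec_edge {n : ℕ} (Kx : Matrix (Fin n) (Fin n) ℝ) (p q : Fin n) :
    frob Kx (Matrix.vecMulVec (edgeVec n p q) (edgeVec n p q))
      = Kx p p - Kx p q - Kx q p + Kx q q := by
  simp only [frob, Matrix.vecMulVec_apply, edgeVec, Pi.sub_apply, Pi.single_apply, mul_sub,
    mul_ite, mul_one, mul_zero, Finset.sum_sub_distrib, Finset.sum_ite_eq', Finset.mem_univ,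
    if_true]
  ring

/-- RH-FREE, PROVED: the KREĬN PAIRING IDENTITY — for a kernel `K(i,j) = η(x_i) + η(x_j) − η(x_i − x_j)`
with `η` even, `⟨K, Lap(c)⟩ = 2 Σ_e c_e (η(x_{p_e} − x_{q_e}) − η(0))`: a Laplacian pairs a Kreĭn
kernel only through the values of ONE real function at the node DIFFERENCES. -/
theorem frob_krein_lapY {n E : ℕ} (η : ℝ → ℝ) (hev : ∀ u, η (-u) = η u) (x : Fin n → ℝ)
    (p q : Fin E → Fin n) (c : Fin E → ℝ) :
    frob (Matrix.of fun i j => η (x i) + η (x j) - η (x i - x j)) (lapY n E p q c)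
      = 2 * ∑ e, c e * (η (x (p e) - x (q e)) - η 0) := by
  unfold lapY
  rw [frob_sum_right, Finset.mul_sum]
  refine Finset.sum_congr rfl fun e _ => ?_
  rw [frob_smul_right, frob_vecMulVec_edge]
  simp only [Matrix.of_apply, sub_self]
  have h1 : η (x (q e) - x (p e)) = η (x (p e) - x (q e)) := by
    rw [← hev (x (p e) - x (q e)), neg_sub]
  rw [h1]
  ring

/-- `⟨S_{n+1}, Lap(c)⟩ = 2 Σ_e c_e Ψ(x_{p_e} − x_{q_e})` (`Ψ` even, `Ψ(0) = 0`). -/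
theorem frob_screw_lapY {n E : ℕ} (p q : Fin E → Fin n) (c : Fin E → ℝ) :
    frob (screwMatrix n) (lapY n E p q c)
      = 2 * ∑ e, c e * zetaScrew (node n (p e) - node n (q e)) := by
  have hS : screwMatrix n = Matrix.of fun i j =>
      zetaScrew (node n i) + zetaScrew (node n j) - zetaScrew (node n i - node n j) := by
    ext i j
    simp [screwMatrix, node, zetaScrewKernel_def]
  rw [hS, frob_krein_lapY zetaScrew zetaScrew_neg]
  simp [zetaScrew_zero]

/-- The band-limited screw-type function of ONE atom: `η_t(u) = (1 − cos(t u))/t²`. -/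
noncomputable def cosEta (t u : ℝ) : ℝ := (1 - Real.cos (t * u)) / t ^ 2

/-- `cosEta t` is an even function. -/
theorem cosEta_neg (t u : ℝ) : cosEta t (-u) = cosEta t u := by
  simp only [cosEta, mul_neg, Real.cos_neg]

/-- `cosEta t` vanishes at `0`. -/
theorem cosEta_zero (t : ℝ) : cosEta t 0 = 0 := by
  simp [cosEta]

/-- Kreĭn form of the wave atom: `A(t)_{ij} = η(x_i) + η(x_j) − η(x_i − x_j)`, `η = cosEta t`. -/
theorem waveAtom_eq_krein (n : ℕ) (t : ℝ) :
    waveAtom n t = Matrix.of fun i j =>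
      cosEta t (node n i) + cosEta t (node n j) - cosEta t (node n i - node n j) := by
  ext i j
  simp only [waveAtom, Matrix.of_apply, cosEta]
  ring

/-- `⟨A_t, Lap(c)⟩ = 2 Σ_e c_e (1 − cos(t (x_{p_e} − x_{q_e})))/t²`. -/
theorem frob_wave_lapY {n E : ℕ} (t : ℝ) (p q : Fin E → Fin n) (c : Fin E → ℝ) :
    frob (waveAtom n t) (lapY n E p q c)
      = 2 * ∑ e, c e * ((1 - Real.cos (t * (node n (p e) - node n (q e)))) / t ^ 2) := by
  rw [waveAtom_eq_krein, frob_krein_lapY (cosEta t) (cosEta_neg t)]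
  simp [cosEta]

/-- `⟨J, Lap(c)⟩ = 0` (`J` is the Kreĭn kernel of the constant function `1`). -/
def oneEta : ℝ → ℝ := fun _ => 1

/-- A signed-edge Laplacian `lapY` is Frobenius-orthogonal to the all-ones matrix `J`. -/
theorem frob_ones_lapY {n E : ℕ} (p q : Fin E → Fin n) (c : Fin E → ℝ) :
    frob (onesMat n) (lapY n E p q c) = 0 := by
  have hJ : onesMat n = Matrix.of fun i j =>
      oneEta (node n i) + oneEta (node n j) - oneEta (node n i - node n j) := by
    ext i j
    simp only [onesMat, oneEta, Matrix.of_apply]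
    norm_num
  rw [hJ, frob_krein_lapY oneEta (fun _ => rfl)]
  simp [oneEta]

/-- RH-FREE, PROVED: SOUNDNESS OF LAPLACIAN DUALS.  If the signed Laplacian of an edge list on the
nodes is in `DD*`, its cosine transform `Σ_e c_e (1 − cos(t d_e))` (`d_e` = node differences) is
nonnegative for `t ∈ [t_min, T]`, and `Σ_e c_e Ψ(d_e) < 0`, then `S_{n+1}` has NO manifest
certificate with frequencies in `[t_min, T]`. -/
theorem lapDual_sound {n E : ℕ} (p q : Fin E → Fin n) (c : Fin E → ℝ) {tmin T : ℝ}
    (htmin : 0 < tmin) (hdd : InDDDual (lapY n E p q c))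
    (hpos : ∀ t, tmin ≤ t → t ≤ T →
      0 ≤ ∑ e, c e * (1 - Real.cos (t * (node n (p e) - node n (q e)))))
    (hneg : ∑ e, c e * zetaScrew (node n (p e) - node n (q e)) < 0) :
    ¬ ManifestCert n tmin T := by
  refine dualCert_sound (Y := lapY n E p q c) ⟨hdd, fun t ht1 ht2 => ?_, ?_, ?_⟩
  · rw [frob_wave_lapY]
    have ht : 0 < t := lt_of_lt_of_le htmin ht1
    have h2 : ∑ e, c e * ((1 - Real.cos (t * (node n (p e) - node n (q e)))) / t ^ 2)
        = (∑ e, c e * (1 - Real.cos (t * (node n (p e) - node n (q e))))) / t ^ 2 := by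
      rw [Finset.sum_div]
      exact Finset.sum_congr rfl fun e _ => by ring
    rw [h2]
    exact mul_nonneg (by norm_num) (div_nonneg (hpos t ht1 ht2) (by positivity))
  · rw [frob_ones_lapY]
  · rw [frob_screw_lapY]
    linarith

end Batch3

end Summit.RiemannHypothesis.RiemannHypothesis.Theorems.IntegerScrew.Manifest
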